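import Mathlib
import Summits.Ventures.PercRepro2.SwOutAll
import Summits.Ventures.PercRepro2.SwOutArmFlip
import Summits.Ventures.PercRepro2.SwOutJunctionsSplit
import Summits.Ventures.PercRepro2.SwOutJunctionsRegion
import Summits.Ventures.PercRepro2.SwOutAdjSplit
import Summits.Ventures.PercRepro2.SwOutAdjFine

/-!
# The class and the side `Q` through the split at a set with internal edges (blind cell
PercRepro2, night-4 g11, 2026-08-25; proofs/NIGHT4-G11.md §5(5))

The lemmas of `SwOutJunctionsRegion` without independence: the class passes to the split graph and
comes back on `S`-fine configurations (`mem_outClass_splitS_of_mem'`, `mem_outClass_of_mem_splitS'`);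
the side `Q` passes and comes back on `S`-fine configurations (`mem_tgtU_splitS_of_mem'`,
`mem_tgtU_of_mem_splitS'`): no vertex of `S` lies in a cluster of `l` (the internal edges play no
role in `Q`).
-/

namespace Summit.Ventures.PercRepro2

namespace LocRows

open Hull

variable {V : Type*} {E : Type*} [Fintype E] [DecidableEq E]

open scoped Classical

variable {ends : E → Sym2 V} {S : Set V} {h : V}

omit [Fintype E] [DecidableEq E] in
/-- An edge touches the split region iff it touches the region (`S ⊆ U`). -/
lemma mem_touches_splitS_iff' {U : Set V} (hS : S ⊆ U) {e : E} :
    e ∈ touches (splitEndsS ends S) (splitRegionS U) ↔ e ∈ touches ends U := by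
  constructor
  · rintro ⟨x', hx', y', hxy⟩
    by_cases he : ∃ u ∈ S, u ∈ ends e
    · obtain ⟨u, huS, hue⟩ := he
      exact ⟨u, hS huS, Sym2.Mem.other hue, ends_eq_otherS hue⟩
    · push Not at he
      have hx'mem : x' ∈ splitEndsS ends S e := by rw [hxy]; exact Sym2.mem_mk_left _ _
      rcases x' with x | e₁
      · obtain ⟨hx, _⟩ := inl_mem_splitEndsS_iff.1 hx'mem
        rcases hx' with ⟨x₁, hx₁, hx₁'⟩ | ⟨e₁, he₁⟩
        · have := Sum.inl.inj hx₁'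
          subst this
          rw [Sym2.mem_iff_exists] at hx
          obtain ⟨y, hy⟩ := hx
          exact ⟨x₁, hx₁, y, hy⟩
        · exact absurd he₁ Sum.inr_ne_inl
      · obtain ⟨_, u, huS, hue⟩ := inr_mem_splitEndsS_iff.1 hx'mem
        exact absurd hue (he u huS)
  · rintro ⟨x, hx, y, hxy⟩
    by_cases he : ∃ u ∈ S, u ∈ ends e
    · obtain ⟨u, huS, hue⟩ := he
      by_cases hi : Internal ends S e
      · exact ⟨Sum.inr e, Or.inr ⟨e, rfl⟩, Sum.inr e, splitEndsS_of_internal hi⟩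
      · exact ⟨Sum.inr e, Or.inr ⟨e, rfl⟩, Sum.inl (Sym2.Mem.other hue),
          splitEndsS_of_not_internal huS hue hi⟩
    · push Not at he
      have hxS : x ∉ S := fun h' => he x h' (by rw [hxy]; exact Sym2.mem_mk_left _ _)
      have hyS : y ∉ S := fun h' => he y h' (by rw [hxy]; exact Sym2.mem_mk_right _ _)
      exact ⟨Sum.inl x, Or.inl ⟨x, hx, rfl⟩, Sum.inl y, splitEndsS_of_notMem hxy hxS hyS⟩

/-- **The class passes to the split** (`S ⊆ U`). -/
theorem mem_outClass_splitS_of_mem' {U : Set V} {ξ η : Config E}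
    (hS : S ⊆ U) (hη : η ∈ outClass ends U h ξ) :
    η ∈ outClass (splitEndsS ends S) (splitRegionS U) (Sum.inl h) ξ := by
  rw [mem_outClass] at hη ⊢
  refine ⟨fun e he => hη.1 e (fun h' => he ((mem_touches_splitS_iff' hS).2 h')), ?_⟩
  rintro v' hv'
  rcases v' with x | e
  · have hx : x ∈ hull ends η h := by
      rcases hv' with h1 | h1
      · exact Or.inl (conn_of_conn_splitS_inl' h1)
      · exact Or.inr (conn_of_conn_splitS_inl' h1)
    exact Or.inl ⟨x, hη.2 hx, rfl⟩
  · exact Or.inr ⟨e, rfl⟩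

/-- **The class comes back from the split** on `S`-fine configurations (`S ⊆ U`, `h ∉ S`). -/
theorem mem_outClass_of_mem_splitS' {U : Set V} {ξ η : Config E}
    (hS : S ⊆ U) (hhS : h ∉ S) (hf : AFine ends S h η)
    (hη : η ∈ outClass (splitEndsS ends S) (splitRegionS U) (Sum.inl h) ξ) :
    η ∈ outClass ends U h ξ := by
  rw [mem_outClass] at hη ⊢
  refine ⟨fun e he => hη.1 e (fun h' => he ((mem_touches_splitS_iff' hS).1 h')), ?_⟩
  intro x hx
  by_cases hxS : x ∈ S
  · exact hS hxS
  · have hx' : Sum.inl x ∈ hull (splitEndsS ends S) η (Sum.inl h) := by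
      rcases hx with h1 | h1
      · exact Or.inl ((inl_mem_cluster_splitS_iff_of_afine hhS hf hxS).2 h1)
      · exact Or.inr ((inl_mem_cluster_splitS_iff_of_afine hhS
          (afine_blue_iff.2 hf) hxS).2 h1)
    rcases hη.2 hx' with ⟨y, hy, hxy⟩ | ⟨e, he⟩
    · exact (Sum.inl.inj hxy) ▸ hy
    · exact absurd he Sum.inr_ne_inl

variable {l o : V}

omit [Fintype E] [DecidableEq E] in
/-- On an `S`-fine configuration with `h ∉ C_R(l)`, no vertex of `S` is in `C_R(l)` (`l ∉ S`). -/
lemma S_notMem_cluster_l_of_afine {η : Config E} (hf : AFine ends S h η)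
    (hhl : h ∉ cluster ends η l) (hlS : l ∉ S) : ∀ u ∈ S, u ∉ cluster ends η l := by
  have key : cluster ends η l ⊆ {x | x ∉ S ∧ x ∈ cluster ends η l} := by
    intro x hx
    refine mem_of_conn_of_closed (ends := ends) (ω := η) ?_ ⟨hlS, mem_cluster_self _ _ _⟩ hx
    intro a ha b hab
    obtain ⟨_, e, he, hends⟩ := openGraph_adj.1 hab
    refine ⟨?_, mem_cluster_of_adj ha.2 hab⟩
    intro hbS
    have hae : a ∈ ends e := by rw [hends]; exact Sym2.mem_mk_left _ _
    have hbe : b ∈ ends e := by rw [hends]; exact Sym2.mem_mk_right _ _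
    have hi : ¬ Internal ends S e := fun hi => ha.1 (hi a hae)
    have haT : a ∈ cluster ends η h := ends_mem_cluster_of_afine hf hbS hbe hi he a hae
    exact hhl (conn_trans ha.2 (conn_symm haT))
  exact fun u huS hu => (key hu).1 huS

/-- **The side `Q` passes to the split** on `S`-fine configurations (`l ∉ S`). -/
theorem mem_tgtU_splitS_of_mem' {η : Config E} (hf : AFine ends S h η)
    (hlS : l ∉ S) (hQ : η ∈ tgtU ends l h {T : Set V | o ∈ T}) :
    η ∈ tgtU (splitEndsS ends S) (Sum.inl l) (Sum.inl h) {T : Set (V ⊕ E) | Sum.inl o ∈ T} := by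
  rw [mem_tgtU_iff'] at hQ ⊢
  obtain ⟨hhl, hoA, hoB⟩ := hQ
  have hhA : h ∉ cluster ends η l := fun h' => hhl (Or.inl h')
  have hhB : h ∉ cluster ends (blue η) l := fun h' => hhl (Or.inr h')
  refine ⟨?_, ?_, ?_⟩
  · rintro (h1 | h1)
    · exact hhA (conn_of_conn_splitS_inl' h1)
    · exact hhB (conn_of_conn_splitS_inl' h1)
  · exact conn_splitS_of_conn' (S_notMem_cluster_l_of_afine hf hhA hlS) hoA
  · exact fun h1 => hoB (conn_of_conn_splitS_inl' h1)

omit [Fintype E] [DecidableEq E] in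
/-- On an `S`-fine configuration whose split side has `inl h ∉ C_R(inl l)`, the red cluster of
`l` is seen by the split (`l ∉ S`). -/
lemma cluster_l_subset_splitS_of_afine (hlS : l ∉ S) {η : Config E} (hf : AFine ends S h η)
    (hhl : Sum.inl h ∉ cluster (splitEndsS ends S) η (Sum.inl l)) :
    cluster ends η l ⊆ {x | Sum.inl x ∈ cluster (splitEndsS ends S) η (Sum.inl l)} := by
  intro v hv
  refine mem_of_conn_of_closed (ends := ends) (ω := η) ?_ (mem_cluster_self _ _ _) hv
  intro x hx y hxy
  obtain ⟨hne, e, he, hends⟩ := openGraph_adj.1 hxy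
  have hxS : x ∉ S := fun h' =>
    inl_S_notMem_cluster_splitS (a := l) h' (fun hlx => hlS (by rw [hlx]; exact h')) hx
  by_cases hyS : y ∈ S
  · exfalso
    have hue : y ∈ ends e := by rw [hends]; exact Sym2.mem_mk_right _ _
    have hoth : Sym2.Mem.other hue = x := other_eq_of_endsS hue (ends_swap hends) hne
    have hi : ¬ Internal ends S e := fun hi => hxS (hi x (by rw [hends]; exact Sym2.mem_mk_left _ _))
    have h1 := inr_mem_cluster_splitS_of_afine hf hyS hue hi he
    rw [inr_mem_cluster_splitS_iff' hyS hue (by rw [hoth]; exact hxS), hoth] at h1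
    exact hhl (conn_trans hx (conn_symm h1.2))
  · exact mem_cluster_of_edge (v := Sum.inl l) hx he (splitEndsS_of_notMem hends hxS hyS)

/-- **The side `Q` comes back from the split** on `S`-fine configurations (`l ∉ S`). -/
theorem mem_tgtU_of_mem_splitS' (hlS : l ∉ S) {η : Config E} (hf : AFine ends S h η)
    (hQ : η ∈ tgtU (splitEndsS ends S) (Sum.inl l) (Sum.inl h) {T : Set (V ⊕ E) | Sum.inl o ∈ T}) :
    η ∈ tgtU ends l h {T : Set V | o ∈ T} := by
  rw [mem_tgtU_iff'] at hQ ⊢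
  obtain ⟨hhl, hoA, hoB⟩ := hQ
  have hhA : Sum.inl h ∉ cluster (splitEndsS ends S) η (Sum.inl l) := fun h' => hhl (Or.inl h')
  have hhB : Sum.inl h ∉ cluster (splitEndsS ends S) (blue η) (Sum.inl l) :=
    fun h' => hhl (Or.inr h')
  have hA := cluster_l_subset_splitS_of_afine hlS hf hhA
  have hB := cluster_l_subset_splitS_of_afine hlS (afine_blue_iff.2 hf) hhB
  refine ⟨?_, conn_of_conn_splitS_inl' hoA, fun h' => hoB (hB h')⟩
  rintro (h1 | h1)
  · exact hhA (hA h1)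
  · exact hhB (hB h1)

end LocRows

end Summit.Ventures.PercRepro2
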